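import Summits.ResolutionOfSingularities.ResolutionOfSingularities.Theorems.FrobeniusLadderFInjectiveMacaulayficationBlowupFiModelOfCover
import Literature.AlgebraicGeometry.Resolution.BlowupChartsFractionField
import Mathlib.RingTheory.Localization.LocalizationLocalization
import Mathlib.RingTheory.Localization.AtPrime.Basic
import HarnessLib

/-!
# Chart swap for the local rings of the affine blowup algebras of a domain: `B[I/s]_𝔔` is a local ring of some `B[I/c_i]` —
# step (H3) of §T2 / 5i `pointFixable_adicTransfer` (crux stmt-ResolutionOfSingularities-15315, chain w45a)

[OURS · L1 W4.5a · res-D-pv-019 AS res-L1-w45a-stub-7] Support file (`--supports stmt-ResolutionOfSingularities-15315 --as helper`)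
for the crux `FrobeniusLadder.FInjectiveMacaulayfication`; NOT a statement of any manuscript; AI-written, weaker than expert review.

For a domain `B`, `I = (c₁, …, c_n)` and any non-zero `s ∈ I`: every local ring `B[I/s]_𝔔` of the chart `D₊(st)` of `Bl_I`
is a local ring `B[I/c_i]_{𝔔_i}` of one of the standard charts, with the same contraction to `B` (`exists_chart_atPrime_ringEquiv`).
This is the affine content of "the `D₊(c_i t)` cover `Proj B[It]`" (Stacks 0804), carried out inside the fraction field `K`:
`B[I/s] ≅ fracChart I s ⊆ K` (`BlowupChartsFractionField`), `Σ b_i (c_i/s) = 1` forces some `u = c_i/s ∉ 𝔴`, and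
`T = B[I/s, I/c_i] ⊆ K` is SIMULTANEOUSLY the localization of `fracChart I s` at `u` and of `fracChart I c_i` at `u⁻¹ = s/c_i`
(`isLocalization_away_of_subalgebra`, `isLocalization_away_of_le`, `exists_eq_mul_pow_of_mem_adjoin`), so the local ring of `T`
at the prime over `𝔴` (`exists_prime_comap_eq_of_away`) is a local ring of both charts (`nonempty_atPrime_ringEquiv_of_comap_eq`);
primes move along `B`-isomorphisms with their contractions and local rings (`comap_algEquiv_prime`). Everything is PROVED; no
definitions, no named facts.
-/

-- single-problem summit: the doubled namespace component is forced
set_option linter.dupNamespace false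

noncomputable section

namespace Summit.ResolutionOfSingularities.ResolutionOfSingularities.Theorems.FInjectiveMacaulayfication.PointFixableChartSwap

open Literature.AlgebraicGeometry.Resolution

/-! ## Generic localization lemmas -/

/-- **A subalgebra `T ⊇ S` of a field with `u⁻¹ ∈ T` and `T = S[u⁻¹]` elementwise is the localization `S[1/u]`.**
[folklore] -/
theorem isLocalization_away_of_subalgebra {B K : Type*} [CommRing B] [Field K] [Algebra B K]
    (S T : Subalgebra B K) [Algebra S T] (halg : ∀ z : S, (algebraMap S T z : K) = z)
    (u : S) (hu0 : (u : K) ≠ 0) (hinv : (u : K)⁻¹ ∈ T)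
    (hgen : ∀ t : K, t ∈ T → ∃ (n : ℕ) (x : K), x ∈ S ∧ t = x * ((u : K)⁻¹) ^ n) :
    IsLocalization.Away u T := by
  have hunit : IsUnit (algebraMap S T u) := by
    refine IsUnit.of_mul_eq_one ⟨_, hinv⟩ (Subtype.ext ?_)
    rw [Subalgebra.coe_mul, halg, Subalgebra.coe_one, mul_inv_cancel₀ hu0]
  refine { map_units := ?_, surj := ?_, exists_of_eq := ?_ }
  · rintro ⟨_, n, rfl⟩
    rw [map_pow]
    exact hunit.pow n
  · intro z
    obtain ⟨n, x, hx, hz⟩ := hgen z z.2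
    refine ⟨(⟨x, hx⟩, ⟨u ^ n, n, rfl⟩), Subtype.ext ?_⟩
    change (z : K) * (algebraMap S T (u ^ n) : K) = (algebraMap S T ⟨x, hx⟩ : K)
    rw [halg, halg, Subalgebra.coe_pow, hz, mul_assoc, ← mul_pow, inv_mul_cancel₀ hu0, one_pow, mul_one]
  · intro a b hab
    refine ⟨1, ?_⟩
    have : (a : K) = b := by rw [← halg a, ← halg b, hab]
    rw [Subtype.ext this]

/-- The local ring of a localization `T = M⁻¹S` at a prime `P` is the local ring of `S` at `𝔴 = P ∩ S`. [folklore] -/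
theorem nonempty_atPrime_ringEquiv_of_comap_eq {S T : Type*} [CommRing S] [CommRing T] [Algebra S T] (M : Submonoid S)
    [IsLocalization M T] (P : Ideal T) [P.IsPrime] (𝔴 : Ideal S) [𝔴.IsPrime] (h𝔴 : P.comap (algebraMap S T) = 𝔴) :
    Nonempty (Localization.AtPrime P ≃+* Localization.AtPrime 𝔴) := by
  subst h𝔴
  haveI : IsLocalization.AtPrime (Localization.AtPrime P) (P.comap (algebraMap S T)) :=
    IsLocalization.isLocalization_isLocalization_atPrime_isLocalization M (Localization.AtPrime P) P
  exact ⟨(IsLocalization.algEquiv (P.comap (algebraMap S T)).primeCompl (Localization.AtPrime P)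
    (Localization.AtPrime (P.comap (algebraMap S T)))).toRingEquiv⟩

/-- Transport of a prime along a `B`-algebra isomorphism `e : R₁ ≃ R₂`: `e⁻¹𝔭` has the same contraction to `B` and the same
local ring. [folklore] -/
theorem comap_algEquiv_prime {B R₁ R₂ : Type*} [CommRing B] [CommRing R₁] [CommRing R₂] [Algebra B R₁] [Algebra B R₂]
    (e : R₁ ≃ₐ[B] R₂) (𝔭 : Ideal R₂) [𝔭.IsPrime] :
    (𝔭.comap e.toRingEquiv.toRingHom).comap (algebraMap B R₁) = 𝔭.comap (algebraMap B R₂) ∧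
      Nonempty (Localization.AtPrime (𝔭.comap e.toRingEquiv.toRingHom) ≃+* Localization.AtPrime 𝔭) := by
  refine ⟨?_, BlowupFiModelOfCover.nonempty_ringEquiv_localization_of_ringEquiv e.toRingEquiv _ 𝔭 fun x => Iff.rfl⟩
  ext b
  simp only [Ideal.mem_comap]
  exact Iff.of_eq (congrArg (· ∈ 𝔭) (e.commutes b))

/-- The same, packaged as a point of `Spec R₁`. [folklore] -/
theorem exists_comap_algEquiv_prime {B R₁ R₂ : Type*} [CommRing B] [CommRing R₁] [CommRing R₂] [Algebra B R₁]
    [Algebra B R₂] (e : R₁ ≃ₐ[B] R₂) (𝔭 : Ideal R₂) [𝔭.IsPrime] :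
    ∃ 𝔴 : PrimeSpectrum R₁, 𝔴.asIdeal.comap (algebraMap B R₁) = 𝔭.comap (algebraMap B R₂) ∧
      Nonempty (Localization.AtPrime 𝔴.asIdeal ≃+* Localization.AtPrime 𝔭) :=
  ⟨⟨𝔭.comap e.toRingEquiv.toRingHom, Ideal.comap_isPrime _ 𝔭⟩, comap_algEquiv_prime e 𝔭⟩

/-- In a localization `T = S[1/u]`, a prime `𝔴` of `S` not containing `u` is the contraction of a prime of `T`. [folklore] -/
theorem exists_prime_comap_eq_of_away {S : Type*} (T : Type*) [CommRing S] [CommRing T] [Algebra S T] (u : S)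
    [IsLocalization.Away u T] (𝔴 : Ideal S) [𝔴.IsPrime] (hu : u ∉ 𝔴) :
    ∃ P : PrimeSpectrum T, P.asIdeal.comap (algebraMap S T) = 𝔴 := by
  have hdisj : Disjoint ((Submonoid.powers u : Submonoid S) : Set S) (𝔴 : Set S) := by
    refine Set.disjoint_left.mpr ?_
    rintro _ ⟨k, rfl⟩ hk
    exact hu (‹𝔴.IsPrime›.mem_of_pow_mem k hk)
  exact ⟨⟨𝔴.map (algebraMap S T), IsLocalization.isPrime_of_isPrime_disjoint (Submonoid.powers u) T 𝔴 ‹_› hdisj⟩,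
    IsLocalization.under_map_of_isPrime_disjoint (Submonoid.powers u) T ‹_› hdisj⟩

/-! ## The two-chart algebra `B[I/G, I/G'] ⊆ K` -/

section TwoCharts

variable {B : Type*} [CommRing B] [IsDomain B] {I : Ideal B} {G G' : B}

/-- Elements of `B[I/G, I/G'] = adjoin (fracChart I G ∪ fracChart I G')` are `x · (G/G')ⁿ` with `x ∈ fracChart I G`
(`y/G'ⁿ = (y/Gⁿ) · (G/G')ⁿ`). [folklore] -/
theorem exists_eq_mul_pow_of_mem_adjoin (hG' : G' ∈ I) (hG0 : G ≠ 0) (hG'0 : G' ≠ 0) {t : FractionRing B}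
    (ht : t ∈ Algebra.adjoin B ((fracChart I G : Set (FractionRing B)) ∪ fracChart I G')) :
    ∃ (n : ℕ) (x : FractionRing B), x ∈ fracChart I G ∧
      t = x * (algebraMap B (FractionRing B) G / algebraMap B (FractionRing B) G') ^ n := by
  have hGK : algebraMap B (FractionRing B) G ≠ 0 :=
    (map_ne_zero_iff _ (IsFractionRing.injective B (FractionRing B))).mpr hG0
  have hG'K : algebraMap B (FractionRing B) G' ≠ 0 :=
    (map_ne_zero_iff _ (IsFractionRing.injective B (FractionRing B))).mpr hG'0
  -- `v = G/G'`, with `G'/G ∈ fracChart I G` and `(G'/G) * v = 1`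
  have hw : algebraMap B (FractionRing B) G' / algebraMap B (FractionRing B) G ∈ fracChart I G := div_mem_fracChart G hG'
  have hwv : algebraMap B (FractionRing B) G' / algebraMap B (FractionRing B) G *
      (algebraMap B (FractionRing B) G / algebraMap B (FractionRing B) G') = 1 := by
    field_simp
  induction ht using Algebra.adjoin_induction with
  | mem t ht =>
    rcases ht with ht | ht
    · exact ⟨0, t, ht, by rw [pow_zero, mul_one]⟩
    · obtain ⟨n, y, hy, rfl⟩ := exists_of_mem_fracChart hG'0 hG' ht
      refine ⟨n, _, div_pow_mem_fracChart hG0 hy, ?_⟩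
      rw [div_pow, div_mul_div_comm, mul_comm (algebraMap B (FractionRing B) G ^ n), mul_div_mul_right _ _ (pow_ne_zero n hGK)]
  | algebraMap r => exact ⟨0, _, Subalgebra.algebraMap_mem _ r, by rw [pow_zero, mul_one]⟩
  | add t₁ t₂ _ _ h₁ h₂ =>
    obtain ⟨n₁, x₁, hx₁, rfl⟩ := h₁
    obtain ⟨n₂, x₂, hx₂, rfl⟩ := h₂
    refine ⟨n₁ + n₂, x₁ * (algebraMap B (FractionRing B) G' / algebraMap B (FractionRing B) G) ^ n₂ +
      x₂ * (algebraMap B (FractionRing B) G' / algebraMap B (FractionRing B) G) ^ n₁,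
      add_mem (mul_mem hx₁ (pow_mem hw n₂)) (mul_mem hx₂ (pow_mem hw n₁)), ?_⟩
    have key : ∀ a b : ℕ, (algebraMap B (FractionRing B) G' / algebraMap B (FractionRing B) G) ^ b *
        (algebraMap B (FractionRing B) G / algebraMap B (FractionRing B) G') ^ (a + b) =
        (algebraMap B (FractionRing B) G / algebraMap B (FractionRing B) G') ^ a := by
      intro a b
      rw [pow_add, mul_comm _ ((algebraMap B (FractionRing B) G / _) ^ b), ← mul_assoc, ← mul_pow, hwv, one_pow,
        one_mul]
    rw [add_mul, mul_assoc, key n₁ n₂, mul_assoc, add_comm n₁ n₂, key n₂ n₁]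
  | mul t₁ t₂ _ _ h₁ h₂ =>
    obtain ⟨n₁, x₁, hx₁, rfl⟩ := h₁
    obtain ⟨n₂, x₂, hx₂, rfl⟩ := h₂
    exact ⟨n₁ + n₂, x₁ * x₂, mul_mem hx₁ hx₂, by rw [pow_add]; ring⟩

/-- **`T = B[I/G, I/G']` is the localization of `fracChart I G` at `G'/G`** (the chart `D₊(Gt) ∩ D₊(G't)` of `Proj B[It]`
as a basic open of `D₊(Gt)`; Stacks 0804 in affine terms), for the inclusion algebra structure; `T` is any subalgebra between
the two charts and the algebra they generate. [folklore] -/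
theorem isLocalization_away_of_le (hG : G ∈ I) (hG' : G' ∈ I) (hG0 : G ≠ 0) (hG'0 : G' ≠ 0)
    {T : Subalgebra B (FractionRing B)} (hle : fracChart I G ≤ T) (hle' : fracChart I G' ≤ T)
    (hT : T ≤ Algebra.adjoin B ((fracChart I G : Set (FractionRing B)) ∪ fracChart I G')) :
    letI := (Subalgebra.inclusion hle).toRingHom.toAlgebra
    IsLocalization.Away (⟨algebraMap B (FractionRing B) G' / algebraMap B (FractionRing B) G, div_mem_fracChart G hG'⟩ :
      fracChart I G) T := by
  letI := (Subalgebra.inclusion hle).toRingHom.toAlgebra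
  have hGK : algebraMap B (FractionRing B) G ≠ 0 :=
    (map_ne_zero_iff _ (IsFractionRing.injective B (FractionRing B))).mpr hG0
  have hG'K : algebraMap B (FractionRing B) G' ≠ 0 :=
    (map_ne_zero_iff _ (IsFractionRing.injective B (FractionRing B))).mpr hG'0
  refine isLocalization_away_of_subalgebra (fracChart I G) T (fun z => rfl) _ (div_ne_zero hG'K hGK) ?_ fun t ht => ?_
  · rw [inv_div]
    exact hle' (div_mem_fracChart G' hG)
  · obtain ⟨n, x, hx, rfl⟩ := exists_eq_mul_pow_of_mem_adjoin hG' hG0 hG'0 (hT ht)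
    exact ⟨n, x, hx, by rw [inv_div]⟩

end TwoCharts

/-! ## The chart swap -/

set_option maxHeartbeats 400000 in
/-- **CHART SWAP.** `B` a domain, `I = (c₁, …, c_n)`, `s ∈ I` non-zero, `𝔔` a prime of `B[I/s]`: for some `i` (with `c_i ≠ 0`)
there is a prime `𝔔_i` of `B[I/c_i]` with the same contraction to `B` and `B[I/c_i]_{𝔔_i} ≅ B[I/s]_𝔔` — every local ring of
every chart `D₊(st)` of `Bl_I(B)` is a local ring of one of the charts `D₊(c_i t)` (Stacks 0804: they cover `Proj B[It]`).
Inside `K = Frac B`: `Σ b_i (c_i/s) = 1` gives `u = c_i/s ∉ 𝔴` (`𝔴` the image of `𝔔` in `fracChart I s`), and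
`T = B[I/s, I/c_i]` is the localization of `fracChart I s` at `u` and of `fracChart I c_i` at `u⁻¹`. [folklore] -/
theorem exists_chart_atPrime_ringEquiv {B : Type} [CommRing B] [IsDomain B] {n : ℕ} (c : Fin n → B) {s : B}
    (hs : s ∈ Ideal.span (Set.range c)) (hs0 : s ≠ 0)
    (𝔔 : Ideal (blowupAlgebra (Ideal.span (Set.range c)) s)) [𝔔.IsPrime] :
    ∃ (i : Fin n) (𝔔ᵢ : PrimeSpectrum (blowupAlgebra (Ideal.span (Set.range c)) (c i))), c i ≠ 0 ∧
      𝔔ᵢ.asIdeal.comap (algebraMap B (blowupAlgebra (Ideal.span (Set.range c)) (c i))) =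
        𝔔.comap (algebraMap B (blowupAlgebra (Ideal.span (Set.range c)) s)) ∧
      Nonempty (Localization.AtPrime 𝔔ᵢ.asIdeal ≃+* Localization.AtPrime 𝔔) := by
  classical
  have hsK : algebraMap B (FractionRing B) s ≠ 0 :=
    (map_ne_zero_iff _ (IsFractionRing.injective B (FractionRing B))).mpr hs0
  have hcI : ∀ i, c i ∈ Ideal.span (Set.range c) := fun i => Ideal.subset_span ⟨i, rfl⟩
  -- the prime `𝔴` of `fracChart I s ≅ B[I/s]`
  obtain ⟨⟨𝔴, h𝔴⟩, h𝔴B, ⟨e₀⟩⟩ :=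
    exists_comap_algEquiv_prime (blowupAlgebraEquivFracChart (Ideal.span (Set.range c)) hs0).symm 𝔔
  dsimp only at h𝔴B e₀
  -- some `u = c i / s ∉ 𝔴`, since `Σ b_i (c_i/s) = 1`
  obtain ⟨b, hb⟩ := Ideal.mem_span_range_iff_exists_fun.mp hs
  obtain ⟨i, hi⟩ : ∃ i : Fin n, (⟨algebraMap B (FractionRing B) (c i) / algebraMap B (FractionRing B) s,
      div_mem_fracChart s (hcI i)⟩ : fracChart (Ideal.span (Set.range c)) s) ∉ 𝔴 := by
    by_contra h
    simp only [not_exists, not_not] at h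
    apply h𝔴.ne_top
    rw [Ideal.eq_top_iff_one]
    have h1 : (1 : fracChart (Ideal.span (Set.range c)) s) =
        ∑ i, algebraMap B (fracChart (Ideal.span (Set.range c)) s) (b i) *
          ⟨algebraMap B (FractionRing B) (c i) / algebraMap B (FractionRing B) s, div_mem_fracChart s (hcI i)⟩ := by
      apply Subtype.ext
      change (1 : FractionRing B) = (fracChart (Ideal.span (Set.range c)) s).val (∑ i, _)
      rw [map_sum]
      simp only [map_mul, Subalgebra.val_apply, Subalgebra.coe_algebraMap]
      symm
      calc ∑ i, algebraMap B (FractionRing B) (b i) * (algebraMap B (FractionRing B) (c i) / algebraMap B (FractionRing B) s)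
          = (∑ i, algebraMap B (FractionRing B) (b i * c i)) / algebraMap B (FractionRing B) s := by
            rw [Finset.sum_div]
            simp only [map_mul, mul_div_assoc]
        _ = 1 := by rw [← map_sum, hb, div_self hsK]
    rw [h1]
    exact Ideal.sum_mem _ fun i _ => Ideal.mul_mem_left _ _ (h i)
  have hci0 : c i ≠ 0 := by
    intro h0
    apply hi
    have : (⟨algebraMap B (FractionRing B) (c i) / algebraMap B (FractionRing B) s, div_mem_fracChart s (hcI i)⟩ :
        fracChart (Ideal.span (Set.range c)) s) = 0 :=
      Subtype.ext (by simp only [h0, map_zero, zero_div, ZeroMemClass.coe_zero])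
    rw [this]
    exact zero_mem _
  -- the two-chart algebra `T = B[I/s, I/c_i]`, a localization of both charts
  have hleS : fracChart (Ideal.span (Set.range c)) s ≤ Algebra.adjoin B
      ((fracChart (Ideal.span (Set.range c)) s : Set (FractionRing B)) ∪ fracChart (Ideal.span (Set.range c)) (c i)) :=
    fun z hz => Algebra.subset_adjoin (Or.inl hz)
  have hleI : fracChart (Ideal.span (Set.range c)) (c i) ≤ Algebra.adjoin B
      ((fracChart (Ideal.span (Set.range c)) s : Set (FractionRing B)) ∪ fracChart (Ideal.span (Set.range c)) (c i)) :=
    fun z hz => Algebra.subset_adjoin (Or.inr hz)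
  -- over `fracChart I s`: a prime `P` of `T` over `𝔴` with `T_P ≅ (fracChart I s)_𝔴`
  obtain ⟨P, hP, e₁⟩ : ∃ P : PrimeSpectrum (Algebra.adjoin B
      ((fracChart (Ideal.span (Set.range c)) s : Set (FractionRing B)) ∪ fracChart (Ideal.span (Set.range c)) (c i))),
      P.asIdeal.comap (Subalgebra.inclusion hleS).toRingHom = 𝔴 ∧
        Nonempty (Localization.AtPrime P.asIdeal ≃+* Localization.AtPrime 𝔴) := by
    letI := (Subalgebra.inclusion hleS).toRingHom.toAlgebra
    haveI := isLocalization_away_of_le hs (hcI i) hs0 hci0 hleS hleI le_rfl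
    obtain ⟨P, hP⟩ := exists_prime_comap_eq_of_away
      (Algebra.adjoin B ((fracChart (Ideal.span (Set.range c)) s : Set (FractionRing B)) ∪ fracChart (Ideal.span (Set.range c)) (c i)))
      (⟨algebraMap B (FractionRing B) (c i) / algebraMap B (FractionRing B) s,
      div_mem_fracChart s (hcI i)⟩ : fracChart (Ideal.span (Set.range c)) s) 𝔴 hi
    exact ⟨P, hP, nonempty_atPrime_ringEquiv_of_comap_eq (Submonoid.powers (⟨algebraMap B (FractionRing B) (c i) /
      algebraMap B (FractionRing B) s, div_mem_fracChart s (hcI i)⟩ : fracChart (Ideal.span (Set.range c)) s)) P.asIdeal 𝔴 hP⟩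
  obtain ⟨e₁⟩ := e₁
  -- over `fracChart I (c i)`: `𝔴ᵢ = P ∩ fracChart I (c i)` with `T_P ≅ (fracChart I (c i))_𝔴ᵢ`
  obtain ⟨e₂⟩ : Nonempty (Localization.AtPrime P.asIdeal ≃+*
      Localization.AtPrime (P.asIdeal.comap (Subalgebra.inclusion hleI).toRingHom)) := by
    letI := (Subalgebra.inclusion hleI).toRingHom.toAlgebra
    haveI := isLocalization_away_of_le (hcI i) hs hci0 hs0 hleI hleS (by rw [Set.union_comm])
    exact nonempty_atPrime_ringEquiv_of_comap_eq (Submonoid.powers (⟨algebraMap B (FractionRing B) s /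
      algebraMap B (FractionRing B) (c i), div_mem_fracChart (c i) hs⟩ : fracChart (Ideal.span (Set.range c)) (c i)))
      P.asIdeal _ rfl
  -- back to `B[I/c_i]`
  obtain ⟨h𝔔ᵢB, ⟨e₃⟩⟩ := comap_algEquiv_prime (blowupAlgebraEquivFracChart (Ideal.span (Set.range c)) hci0)
    (P.asIdeal.comap (Subalgebra.inclusion hleI).toRingHom)
  refine ⟨i, ⟨_, Ideal.comap_isPrime _ _⟩, hci0, ?_, ⟨e₃.trans (e₂.symm.trans (e₁.trans e₀))⟩⟩
  -- contractions to `B`: all equal to `P ∩ B`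
  rw [h𝔔ᵢB, ← h𝔴B, ← hP]
  change (P.asIdeal.comap (Subalgebra.inclusion hleI)).comap _ = (P.asIdeal.comap (Subalgebra.inclusion hleS)).comap _
  rw [comap_comap_inclusion, comap_comap_inclusion]

end Summit.ResolutionOfSingularities.ResolutionOfSingularities.Theorems.FInjectiveMacaulayfication.PointFixableChartSwap

end
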